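import Summits.QuantumAdvantage.QuantumAdvantage.Theorems.RandomOracleGaugeDecoupledCoreAAL1FamilyBooleanCorner
import Summits.QuantumAdvantage.QuantumAdvantage.Theorems.RandomOracleGaugeDecoupledCoreAAL1FamilyPoincare
import HarnessLib

/-!
# Crux `DecoupledCoreAA` (stmt-QuantumAdvantage-17872), line `l1-family`, stub `stub_l1Family` —
# the ROBUST Boolean corner: ℓ¹-families `L²`-close to a signed partition satisfy the dichotomy polynomially

`…L1FamilyBooleanCorner` proves the registered dichotomy at scale `1/(256 d³)` for SIGNED-PARTITION families (those
whose decoupled polynomial is Boolean; the address family's class).  This file makes it ROBUST: if an ℓ¹-bounded family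
`g` of degree `≤ d` and total mass `V` is within squared `L²`-distance `V/4` of SOME signed-partition family `h` of
degree `≤ d` — `Σ_i E[(g_i − h_i)²] ≤ V/4` — then
`(∃ i, E[g_i²] ≥ V²/(262144 d⁶)) ∨ (∃ j, Σ_i E[(g_i − g_i^{⊕j})²] ≥ V²/(65536 d⁶))`.

Mechanism: the decoupled polynomials `p` (of `g`) and `q` (of `h`, Boolean, in `K_{d+1}`) satisfy
`E[(p − q)²] = ¼ Σ_i E[(g_i − h_i)²]` (the difference is again decoupled; orthogonality of the signs) and `Var p = V/4`,
so the tree's robust corner `BooleanCorner.exists_influence_ge_of_near_booleanCorner` (pure OSSS + `D ≤ 32T³`) gives a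
variable of `p` with `Var[p]² ≤ 256 (d+1)⁶ · Inf`; read it back through `stub_derivativeFamily`.

* §1 `evalBool_decoupledOf_sub` (difference of decoupled polynomials), `boolAvg_sq_sub_decoupled`
  (`E[(p−q)²] = ¼ Σ_i E[(g_i − h_i)²]`), `decoupledOf_boolean_of_signedPartition`.
* §2 `l1Family_nearSignedPartition` (the display above); §3 `l1Family_of_nearSignedPartition` — the REGISTERED
  statement of `stub_l1Family` with the extra hypothesis "some signed partition of degree `≤ d` is `V/4`-close", for
  every regime, `(c, C) = (2κ₀ + 6, 1/(262144 K₀²))`.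

Reading for the open stub: a counterexample family (if the Aaronson–Ambainis conjecture fails) must keep squared
`L²`-distance `> V/4` from EVERY low-degree signed partition — far from all address-like configurations.  Honest label:
known robust Boolean case (OSSS) transported; no stub, crux or summit is closed.  Sources: O'Donnell–Saks–Schramm–
Servedio 2005 Thm 3.2; Midrijanis 2004; O'Donnell–Zhao arXiv:1512.01603 eqn. (2.1).
-/

-- D-0017: single-conjunct summit ⇒ the duplicate `QuantumAdvantage.QuantumAdvantage` is mandated.
set_option linter.dupNamespace false

noncomputable section

open Finset
open Literature.Computability.QuantumComplexity
open Summit.QuantumAdvantage.QuantumAdvantage.Cruxes.DecoupledCoreAA.L1Family.Equiv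
  (evalBool_decoupledOf totalDegree_decoupledOf_le decoupledOf_bounded boolAvg_half_sq)
open Summit.QuantumAdvantage.QuantumAdvantage.Cruxes.DecoupledCoreAA.L1Family.BooleanCorner
  (pseudoBounded_of_boolean sum_abs_eq_one_of_signedPartition sum_sign_mul_half_sq)
open Summit.QuantumAdvantage.QuantumAdvantage.Cruxes.DecoupledCoreAA.L1Family.Poincare (boolVariance_eq_sq_sub)
open Summit.QuantumAdvantage.QuantumAdvantage.Theorems.SosSandwich.BooleanCorner
  (exists_influence_ge_of_near_booleanCorner)

namespace Summit.QuantumAdvantage.QuantumAdvantage.Cruxes.DecoupledCoreAA.L1Family.NearBoolean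

variable {N : ℕ}

/-! ### §1 The difference of two decoupled polynomials -/

/-- The difference of the decoupled polynomials of two families is the decoupled (mean-zero) polynomial of the
difference family: `(p_g − p_h)(y,z) = 0 + Σ_i (±1)^{y_i}·½(g_i(z) − h_i(z))`. [cite: ODonnellZhao2016, eqn. (2.1)] -/
theorem evalBool_decoupledOf_sub (g h : Fin N → MvPolynomial (Fin N) ℝ) (y z : Fin N → Bool) :
    evalBool ((MvPolynomial.C (1 / 2 : ℝ) +
        ∑ i, (MvPolynomial.X (Fin.castAdd N i) - MvPolynomial.C (1 / 2 : ℝ)) *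
          MvPolynomial.rename (Fin.natAdd N) (g i)) -
      (MvPolynomial.C (1 / 2 : ℝ) +
        ∑ i, (MvPolynomial.X (Fin.castAdd N i) - MvPolynomial.C (1 / 2 : ℝ)) *
          MvPolynomial.rename (Fin.natAdd N) (h i))) (Fin.append y z) =
      0 + ∑ i, (if y i then (1 : ℝ) else -1) * (1 / 2 * (evalBool (g i) z - evalBool (h i) z)) := by
  have e : ∀ (a b : MvPolynomial (Fin (N + N)) ℝ) (x : Fin (N + N) → Bool),
      evalBool (a - b) x = evalBool a x - evalBool b x := by
    intro a b x; unfold evalBool; rw [map_sub]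
  rw [e, evalBool_decoupledOf, evalBool_decoupledOf, zero_add, add_sub_add_left_eq_sub, ← Finset.sum_sub_distrib]
  refine Finset.sum_congr rfl fun i _ => ?_
  ring

/-- **`E[(p_g − p_h)²] = ¼ Σ_i E[(g_i − h_i)²]`** for the decoupled polynomials of two families (the difference is
decoupled with mean `0`; orthogonality of the signs `(±1)^{y_i}`). [cite: ODonnellZhao2016, eqn. (2.1)] -/
theorem boolAvg_sq_sub_decoupled (g h : Fin N → MvPolynomial (Fin N) ℝ) :
    boolAvg (fun x => (evalBool (MvPolynomial.C (1 / 2 : ℝ) +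
        ∑ i, (MvPolynomial.X (Fin.castAdd N i) - MvPolynomial.C (1 / 2 : ℝ)) *
          MvPolynomial.rename (Fin.natAdd N) (g i)) x -
      evalBool (MvPolynomial.C (1 / 2 : ℝ) +
        ∑ i, (MvPolynomial.X (Fin.castAdd N i) - MvPolynomial.C (1 / 2 : ℝ)) *
          MvPolynomial.rename (Fin.natAdd N) (h i)) x) ^ 2) =
      1 / 4 * ∑ i, boolAvg (fun z => (evalBool (g i) z - evalBool (h i) z) ^ 2) := by
  set r : MvPolynomial (Fin (N + N)) ℝ := (MvPolynomial.C (1 / 2 : ℝ) +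
        ∑ i, (MvPolynomial.X (Fin.castAdd N i) - MvPolynomial.C (1 / 2 : ℝ)) *
          MvPolynomial.rename (Fin.natAdd N) (g i)) -
      (MvPolynomial.C (1 / 2 : ℝ) +
        ∑ i, (MvPolynomial.X (Fin.castAdd N i) - MvPolynomial.C (1 / 2 : ℝ)) *
          MvPolynomial.rename (Fin.natAdd N) (h i)) with hr
  have hform : ∀ y z : Fin N → Bool, evalBool r (Fin.append y z) =
      0 + ∑ i, (if y i then (1 : ℝ) else -1) * ((fun i z => 1 / 2 * (evalBool (g i) z - evalBool (h i) z)) i z) :=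
    fun y z => evalBool_decoupledOf_sub g h y z
  have hsub : (fun x => (evalBool (MvPolynomial.C (1 / 2 : ℝ) +
        ∑ i, (MvPolynomial.X (Fin.castAdd N i) - MvPolynomial.C (1 / 2 : ℝ)) *
          MvPolynomial.rename (Fin.natAdd N) (g i)) x -
      evalBool (MvPolynomial.C (1 / 2 : ℝ) +
        ∑ i, (MvPolynomial.X (Fin.castAdd N i) - MvPolynomial.C (1 / 2 : ℝ)) *
          MvPolynomial.rename (Fin.natAdd N) (h i)) x) ^ 2) = fun x => evalBool r x ^ 2 := by
    funext x
    rw [hr]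
    unfold evalBool
    rw [map_sub]
  rw [hsub]
  have hmean : boolAvg (evalBool r) = 0 := StubDerivativeFamily.boolAvg_decoupled hform
  have hvar : boolVariance r = ∑ i, boolAvg (fun z =>
      ((fun i z => 1 / 2 * (evalBool (g i) z - evalBool (h i) z)) i z) ^ 2) :=
    StubDerivativeFamily.boolVariance_decoupled hform
  have hsq : boolAvg (fun x => evalBool r x ^ 2) = boolVariance r + boolAvg (evalBool r) ^ 2 := by
    rw [boolVariance_eq_sq_sub]; ring
  rw [hsq, hmean, hvar, Finset.mul_sum]
  simp only
  rw [zero_pow two_ne_zero, add_zero]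
  exact Finset.sum_congr rfl fun i _ => boolAvg_half_sq _

/-- The decoupled polynomial of a signed-partition family is `{0,1}`-valued. [folklore] -/
theorem decoupledOf_boolean_of_signedPartition (h : Fin N → MvPolynomial (Fin N) ℝ)
    (hpart : ∀ z, ∃ i, |evalBool (h i) z| = 1 ∧ ∀ k, k ≠ i → evalBool (h k) z = 0)
    (x : Fin (N + N) → Bool) :
    evalBool (MvPolynomial.C (1 / 2 : ℝ) +
        ∑ i, (MvPolynomial.X (Fin.castAdd N i) - MvPolynomial.C (1 / 2 : ℝ)) *
          MvPolynomial.rename (Fin.natAdd N) (h i)) x = 0 ∨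
    evalBool (MvPolynomial.C (1 / 2 : ℝ) +
        ∑ i, (MvPolynomial.X (Fin.castAdd N i) - MvPolynomial.C (1 / 2 : ℝ)) *
          MvPolynomial.rename (Fin.natAdd N) (h i)) x = 1 := by
  classical
  rw [← Fin.append_castAdd_natAdd (f := x), evalBool_decoupledOf]
  have hsq := sum_sign_mul_half_sq h hpart (fun i => x (Fin.castAdd N i)) (fun i => x (Fin.natAdd N i))
  set s := ∑ i, (if x (Fin.castAdd N i) then (1 : ℝ) else -1) * (1 / 2 * evalBool (h i) fun i => x (Fin.natAdd N i))
    with hs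
  have : (s - 1 / 2) * (s + 1 / 2) = 0 := by nlinarith [hsq]
  rcases mul_eq_zero.mp this with h0 | h0
  · right; linarith
  · left; linarith

/-! ### §2 The robust Boolean corner of the dichotomy -/

/-- **Robust Boolean corner of `stub_l1Family`.**  Let `g : Fin N → ℝ[x_1..x_N]` be ℓ¹-bounded (`Σ_i |g_i(z)| ≤ 1`)
of degree `≤ d` (`d ≥ 1`) with total mass `V = Σ_i E[g_i²] > 0`, and let `h` be a signed partition of degree `≤ d` with
`Σ_i E[(g_i − h_i)²] ≤ V/4`.  Then `(∃ i, E[g_i²] ≥ V²/(262144 d⁶)) ∨ (∃ j, Σ_i E[(g_i − g_i^{⊕j})²] ≥ V²/(65536 d⁶))`.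
[cite: OdonnellEtAl2005, Thm 3.2] [cite: Midrijanis2004, Thm 4] [cite: ODonnellZhao2016, eqn. (2.1)] -/
theorem l1Family_nearSignedPartition {N d : ℕ} (g h : Fin N → MvPolynomial (Fin N) ℝ) (hd : 1 ≤ d)
    (hdeg : ∀ i, (g i).totalDegree ≤ d) (hhdeg : ∀ i, (h i).totalDegree ≤ d)
    (hl1 : ∀ z, ∑ i, |evalBool (g i) z| ≤ 1)
    (hpart : ∀ z, ∃ i, |evalBool (h i) z| = 1 ∧ ∀ k, k ≠ i → evalBool (h k) z = 0)
    (hclose : ∑ i, boolAvg (fun z => (evalBool (g i) z - evalBool (h i) z) ^ 2) ≤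
      1 / 4 * ∑ i, boolAvg (fun z => evalBool (g i) z ^ 2))
    (hV : 0 < ∑ i, boolAvg (fun z => evalBool (g i) z ^ 2)) :
    (∃ i, (∑ i, boolAvg (fun z => evalBool (g i) z ^ 2)) ^ 2 / (262144 * (d : ℝ) ^ 6) ≤
      boolAvg (fun z => evalBool (g i) z ^ 2)) ∨
    (∃ j, (∑ i, boolAvg (fun z => evalBool (g i) z ^ 2)) ^ 2 / (65536 * (d : ℝ) ^ 6) ≤
      ∑ i, boolAvg (fun z => (evalBool (g i) z - evalBool (g i) (flipBit j z)) ^ 2)) := by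
  classical
  set V := ∑ i, boolAvg (fun z => evalBool (g i) z ^ 2) with hVdef
  -- the two decoupled polynomials
  set p : MvPolynomial (Fin (N + N)) ℝ := MvPolynomial.C (1 / 2 : ℝ) +
    ∑ i, (MvPolynomial.X (Fin.castAdd N i) - MvPolynomial.C (1 / 2 : ℝ)) *
      MvPolynomial.rename (Fin.natAdd N) (g i) with hp
  set q : MvPolynomial (Fin (N + N)) ℝ := MvPolynomial.C (1 / 2 : ℝ) +
    ∑ i, (MvPolynomial.X (Fin.castAdd N i) - MvPolynomial.C (1 / 2 : ℝ)) *
      MvPolynomial.rename (Fin.natAdd N) (h i) with hq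
  set g' : Fin N → (Fin N → Bool) → ℝ := fun i z => 1 / 2 * evalBool (g i) z with hg'
  have hformp : ∀ y z : Fin N → Bool,
      evalBool p (Fin.append y z) = 1 / 2 + ∑ i, (if y i then (1 : ℝ) else -1) * g' i z :=
    fun y z => evalBool_decoupledOf g y z
  have hpdeg : p.totalDegree ≤ d + 1 := totalDegree_decoupledOf_le g hdeg
  have hpb : ∀ x, 0 ≤ evalBool p x ∧ evalBool p x ≤ 1 := decoupledOf_bounded g hl1
  have hqdeg : q.totalDegree ≤ d + 1 := totalDegree_decoupledOf_le h hhdeg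
  have hq01 : ∀ x, evalBool q x = 0 ∨ evalBool q x = 1 := decoupledOf_boolean_of_signedPartition h hpart
  have hqPB : PseudoBounded (d + 1) q := pseudoBounded_of_boolean hqdeg hq01
  -- data of `p`
  obtain ⟨-, hinfy, hinfz, hvar, -⟩ := stub_derivativeFamily N (d + 1) p (1 / 2) g' hformp hpdeg hpb
  have hmass : ∀ i, boolAvg (fun z => g' i z ^ 2) = 1 / 4 * boolAvg (fun z => evalBool (g i) z ^ 2) :=
    fun i => boolAvg_half_sq _
  have hdiff : ∀ j i, boolAvg (fun z => (g' i z - g' i (flipBit j z)) ^ 2) =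
      1 / 4 * boolAvg (fun z => (evalBool (g i) z - evalBool (g i) (flipBit j z)) ^ 2) := by
    intro j i
    have e : (fun z => (g' i z - g' i (flipBit j z)) ^ 2) =
        fun z => (1 / 2 * (evalBool (g i) z - evalBool (g i) (flipBit j z))) ^ 2 := by
      funext z; rw [hg']; ring
    rw [e]
    exact boolAvg_half_sq _
  have hvarV : boolVariance p = 1 / 4 * V := by
    rw [hvar, hVdef, Finset.mul_sum]
    exact Finset.sum_congr rfl fun i _ => hmass i
  have hvpos : 0 < boolVariance p := by rw [hvarV]; positivity
  -- the approximation hypothesis of the robust corner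
  have happrox : 4 * boolAvg (fun x => (evalBool p x - evalBool q x) ^ 2) ≤ boolVariance p := by
    rw [hp, hq, boolAvg_sq_sub_decoupled g h, hvarV]
    linarith
  obtain ⟨j, hj⟩ := exists_influence_ge_of_near_booleanCorner hqPB hq01 p happrox hvpos
  rw [hvarV] at hj
  -- `(d+1)^6 ≤ 64 d^6`
  have hd1 : (1 : ℝ) ≤ (d : ℝ) := by exact_mod_cast hd
  have hd0 : (0 : ℝ) < (d : ℝ) := by positivity
  have hpow : ((d + 1 : ℕ) : ℝ) ^ 6 ≤ 64 * (d : ℝ) ^ 6 := by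
    have h2 : ((d + 1 : ℕ) : ℝ) ≤ 2 * (d : ℝ) := by push_cast; linarith
    calc ((d + 1 : ℕ) : ℝ) ^ 6 ≤ (2 * (d : ℝ)) ^ 6 := pow_le_pow_left₀ (by positivity) h2 6
      _ = 64 * (d : ℝ) ^ 6 := by ring
  have hI := influence_nonneg j p
  have hInf : V ^ 2 / (262144 * (d : ℝ) ^ 6) ≤ influence j p := by
    rw [div_le_iff₀ (by positivity)]
    nlinarith [hj, hpow, hI, sq_nonneg V]
  -- case split on the influential variable of `p`
  revert hInf
  refine Fin.addCases (fun i => ?_) (fun j' => ?_) j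
  · intro hInf
    left
    refine ⟨i, ?_⟩
    rw [hinfy i, hmass i] at hInf
    linarith
  · intro hInf
    right
    refine ⟨j', ?_⟩
    rw [hinfz j'] at hInf
    simp_rw [hdiff j'] at hInf
    rw [← Finset.mul_sum] at hInf
    have e : V ^ 2 / (65536 * (d : ℝ) ^ 6) = 4 * (V ^ 2 / (262144 * (d : ℝ) ^ 6)) := by
      field_simp; ring
    rw [e]
    linarith

/-! ### §3 The registered statement near the Boolean corner -/

/-- **`stub_l1Family` near the Boolean corner, for every regime.**  The REGISTERED statement of `stub_l1Family` with
the extra hypothesis "some signed partition `h` of degree `≤ d` has `Σ_i E[(g_i − h_i)²] ≤ V/4`", witnessed by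
`(c, C) := (2κ₀ + 6, 1/(262144 K₀²))`. [cite: OdonnellEtAl2005, Thm 3.2] [cite: ODonnellZhao2016, Thm. 2.13] -/
theorem l1Family_of_nearSignedPartition :
    ∀ (κ₀ : ℕ) (K₀ : ℝ), 0 < K₀ → ∃ (c : ℕ) (C : ℝ), 0 < C ∧
      ∀ (N d : ℕ) (g : Fin N → MvPolynomial (Fin N) ℝ),
        (∃ h : Fin N → MvPolynomial (Fin N) ℝ, (∀ i, (h i).totalDegree ≤ d) ∧
          (∀ z, ∃ i, |evalBool (h i) z| = 1 ∧ ∀ k, k ≠ i → evalBool (h k) z = 0) ∧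
          ∑ i, boolAvg (fun z => (evalBool (g i) z - evalBool (h i) z) ^ 2) ≤
            1 / 4 * ∑ i, boolAvg (fun z => evalBool (g i) z ^ 2)) →
        1 ≤ d → (∀ i, (g i).totalDegree ≤ d) →
        (∀ z, ∑ i, |evalBool (g i) z| ≤ 1) →
        1 ≤ K₀ * (d : ℝ) ^ κ₀ * ∑ i, boolAvg (fun z => evalBool (g i) z ^ 2) →
        (∃ i, C / (d : ℝ) ^ c ≤ boolAvg (fun z => evalBool (g i) z ^ 2)) ∨
        (∃ j, C / (d : ℝ) ^ c ≤
          ∑ i, boolAvg (fun z => (evalBool (g i) z - evalBool (g i) (flipBit j z)) ^ 2)) := by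
  intro κ₀ K₀ hK₀
  refine ⟨2 * κ₀ + 6, 1 / (262144 * K₀ ^ 2), by positivity, ?_⟩
  intro N d g hnear hd hdeg hl1 hreg
  obtain ⟨h, hhdeg, hpart, hclose⟩ := hnear
  set V := ∑ i, boolAvg (fun z => evalBool (g i) z ^ 2) with hVdef
  have hd0 : (0 : ℝ) < (d : ℝ) := by exact_mod_cast hd
  have hKd : 0 < K₀ * (d : ℝ) ^ κ₀ := by positivity
  have hVge : 1 / (K₀ * (d : ℝ) ^ κ₀) ≤ V := by
    rw [div_le_iff₀ hKd]
    linarith [hreg, mul_comm (K₀ * (d : ℝ) ^ κ₀) V]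
  have hVpos : 0 < V := lt_of_lt_of_le (by positivity) hVge
  have hsq : 1 / (K₀ ^ 2 * (d : ℝ) ^ (2 * κ₀)) ≤ V ^ 2 := by
    have e : 1 / (K₀ ^ 2 * (d : ℝ) ^ (2 * κ₀)) = (1 / (K₀ * (d : ℝ) ^ κ₀)) ^ 2 := by
      rw [pow_mul, div_pow, one_pow, mul_pow, ← pow_mul, ← pow_mul, mul_comm κ₀ 2]
    rw [e]
    exact pow_le_pow_left₀ (by positivity) hVge 2
  -- `C/d^c = (1/(K₀² d^{2κ₀})) / (262144 d⁶)`
  have hC : 1 / (262144 * K₀ ^ 2) / (d : ℝ) ^ (2 * κ₀ + 6) =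
      (1 / (K₀ ^ 2 * (d : ℝ) ^ (2 * κ₀))) / (262144 * (d : ℝ) ^ 6) := by
    rw [pow_add]
    field_simp
  rcases l1Family_nearSignedPartition g h hd hdeg hhdeg hl1 hpart hclose hVpos with ⟨i, hi⟩ | ⟨j, hj⟩
  · left
    refine ⟨i, le_trans ?_ hi⟩
    rw [hC]
    exact div_le_div_of_nonneg_right hsq (by positivity)
  · right
    refine ⟨j, le_trans ?_ hj⟩
    rw [hC]
    calc (1 / (K₀ ^ 2 * (d : ℝ) ^ (2 * κ₀))) / (262144 * (d : ℝ) ^ 6)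
        ≤ V ^ 2 / (262144 * (d : ℝ) ^ 6) := div_le_div_of_nonneg_right hsq (by positivity)
      _ ≤ V ^ 2 / (65536 * (d : ℝ) ^ 6) :=
          div_le_div_of_nonneg_left (sq_nonneg V) (by positivity) (by nlinarith [pow_pos hd0 6])

end Summit.QuantumAdvantage.QuantumAdvantage.Cruxes.DecoupledCoreAA.L1Family.NearBoolean

end
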